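import Mathlib
import Summits.CriticalPhenomena.CardyFormulaZ2.Theorems.CardyMagicRigidityPositiveConeJointDefs
import Summits.CriticalPhenomena.CardyFormulaZ2.Theorems.CardyMagicRigidityNestingRigiditySoftMachineCounting
import Summits.CriticalPhenomena.CardyFormulaZ2.Theorems.CardyMagicRigidityNestingRigiditySoftMachineSiteAll
import Summits.CriticalPhenomena.CardyFormulaZ2.Theorems.CardyMagicRigidityNestingRigiditySoftMachineBond
import Summits.CriticalPhenomena.CardyFormulaZ2.Theorems.CardyMagicRigidityNestingRigidityFusionBaseCases
import Literature.Probability.RandomPlanarGeometry.LoopWinding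
import HarnessLib

/-!
# Soft machine, brick 13: measurable typed counts; `TamePrecompact` reduced to tame-regular modification

Crux `Summit.CriticalPhenomena.CardyFormulaZ2.Theses.CardyMagicRigidity.NestingRigidity`
(stmt-CriticalPhenomena-4835), line `positive-cone-weight-doubling`, registered stub `stub_tamePrecompactness :
TamePrecompact zEns ∧ TamePrecompact tEns` (vocabulary p130599).  Last soft brick:

* `SoftMachine.isOpen_patternSet` — the set of unbased loops counted by `patternCount` / `typedPatternCount` (trace
  in the open window, surrounding the discs of `S`, avoiding the others) is OPEN in DKKMO's space of unbased loops:
  the winding number `W(u, z)` is locally constant in `u` uniformly for `z` in a compact set off the trace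
  (`UnbasedLoop.wind_eq_of_dist_lt`), traces move continuously, and `W = 0` on the trace
  (`unbasedLoop_wind_of_mem_range`);
* `SoftMachine.measurable_typedPatternCount_of_hit` — hence, for every presentation `X` with measurable hitting
  events of closed sets, the typed counts `s ↦ typedPatternCount (X s) i x r R S` are measurable
  (`softMachine_measurable_ncard_of_hit`, brick 12);
* `tamePrecompact_tEns_of_tameRegularModification` (registered anchor) — **`TamePrecompact tEns` holds as soon as
  every hit-measurable sequential `d_CN`-limit presentation of `tEns` can be replaced by a hit-measurable,
  a.e. TAME-REGULAR one with the same limit property** (the hard limit fields: boundary, separating, dust,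
  tameness); the soft clauses (measurable typed counts, measurable closeness events at every mesh against both
  lattices, the subsequential convergence itself) are ALL theorems now (bricks 6–9, 12);
  `tamePrecompact_zEns_of_traversalBound_of_tameRegularModification` — the same for `zEns` given the bond
  multiple-traversal estimate (brick 11).
-/

noncomputable section

open MeasureTheory Set Filter Metric TopologicalSpace Function
open scoped Topology ENNReal NNReal unitInterval

namespace Summit.CriticalPhenomena.CardyFormulaZ2.Cruxes.NestingRigidity.PositiveConeWeightDoubling

open Literature.Probability.RandomPlanarGeometry Literature.Probability.Percolation
  Literature.Probability.LatticeModels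
open Summit.CriticalPhenomena.CardyFormulaZ2.Cruxes.NestingRigidity.RingCloudTomography

namespace SoftMachine

/-! ### Winding numbers: locally constant off a compact set (zero on the trace: `unbasedLoop_wind_of_mem_range`) -/

/-- **Uniform local constancy of the winding number off a compact set**: if the compact set `K` misses the trace
of `u`, then every `v` close enough to `u` (in the oriented unbased distance) misses `K` with its trace and has the
same winding numbers as `u` at every point of `K`. -/
theorem exists_forall_wind_eq_of_disjoint (u : UnbasedLoop ℂ) {K : Set ℂ} (hK : IsCompact K)
    (hdisj : Disjoint K u.range) :
    ∃ g : ℝ, 0 < g ∧ ∀ v : UnbasedLoop ℂ, dist v u < g → Disjoint K v.range ∧ ∀ z ∈ K, v.wind z = u.wind z := by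
  rcases K.eq_empty_or_nonempty with rfl | hne
  · exact ⟨1, one_pos, fun v _ ↦ ⟨Set.empty_disjoint _, fun z hz ↦ absurd hz (notMem_empty z)⟩⟩
  · obtain ⟨z₀, hz₀, hmin⟩ := hK.exists_isMinOn hne (continuous_infDist_pt u.range).continuousOn
    set g : ℝ := infDist z₀ u.range with hg
    have hgpos : 0 < g :=
      (u.isCompact_range.isClosed.notMem_iff_infDist_pos u.range_nonempty).1 (disjoint_left.1 hdisj hz₀)
    refine ⟨g, hgpos, fun v hv ↦ ⟨disjoint_left.2 fun z hzK hzv ↦ ?_, fun z hzK ↦ ?_⟩⟩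
    · have h1 : infDist z u.range ≤ dist v u := UnbasedLoop.infDist_range_le_dist v u hzv
      have h2 : g ≤ infDist z u.range := hmin hzK
      linarith
    · refine UnbasedLoop.wind_eq_of_dist_lt ?_
      rw [dist_comm]
      exact hv.trans_le (hmin hzK)

/-- The unbased loops whose winding number is nonzero on all of a compact set `K` form an open set. -/
theorem isOpen_setOf_subset_wind_ne_zero {K : Set ℂ} (hK : IsCompact K) :
    IsOpen {u : UnbasedLoop ℂ | K ⊆ {z | u.wind z ≠ 0}} := by
  rw [Metric.isOpen_iff]
  intro u hu
  have hdisj : Disjoint K u.range := disjoint_left.2 fun z hzK hzr ↦ hu hzK (unbasedLoop_wind_of_mem_range u hzr)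
  obtain ⟨g, hg, h⟩ := exists_forall_wind_eq_of_disjoint u hK hdisj
  refine ⟨g, hg, fun v hv z hzK ↦ ?_⟩
  rw [mem_setOf_eq, (h v hv).2 z hzK]
  exact hu hzK

/-- The unbased loops avoiding a compact set `K` with their interior AND their trace form an open set. -/
theorem isOpen_setOf_disjoint_interior_union_range {K : Set ℂ} (hK : IsCompact K) :
    IsOpen {u : UnbasedLoop ℂ | Disjoint K ({z | u.wind z ≠ 0} ∪ u.range)} := by
  rw [Metric.isOpen_iff]
  intro u hu
  rw [mem_setOf_eq, disjoint_union_right] at hu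
  obtain ⟨g, hg, h⟩ := exists_forall_wind_eq_of_disjoint u hK hu.2
  refine ⟨g, hg, fun v hv ↦ ?_⟩
  rw [mem_setOf_eq, disjoint_union_right]
  refine ⟨disjoint_left.2 fun z hzK hzw ↦ ?_, (h v hv).1⟩
  rw [mem_setOf_eq, (h v hv).2 z hzK] at hzw
  exact disjoint_left.1 hu.1 hzK hzw

/-- **The pattern sets are open**: loops inside the window `B(0, R)` surrounding exactly the closed discs indexed by
`S` (interior contains them) and avoiding the others (disc off the interior and off the trace). -/
theorem isOpen_patternSet {n : ℕ} (x : Fin n → ℂ) (r : Fin n → ℝ) (R : ℝ) (S : Finset (Fin n)) :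
    IsOpen {u : UnbasedLoop ℂ | u.range ⊆ ball (0 : ℂ) R ∧
      (∀ j ∈ S, closedBall (x j) (r j) ⊆ {w | u.wind w ≠ 0}) ∧
      ∀ j, j ∉ S → Disjoint (closedBall (x j) (r j)) ({w | u.wind w ≠ 0} ∪ u.range)} := by
  have h1 : IsOpen {u : UnbasedLoop ℂ | u.range ⊆ ball (0 : ℂ) R} := isOpen_setOf_unbased_range_subset isOpen_ball
  have h2 : IsOpen (⋂ j ∈ S, {u : UnbasedLoop ℂ | closedBall (x j) (r j) ⊆ {w | u.wind w ≠ 0}}) :=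
    S.finite_toSet.isOpen_biInter fun j _ ↦ isOpen_setOf_subset_wind_ne_zero (isCompact_closedBall _ _)
  have h3 : IsOpen (⋂ j ∈ {j : Fin n | j ∉ S}, {u : UnbasedLoop ℂ |
      Disjoint (closedBall (x j) (r j)) ({w | u.wind w ≠ 0} ∪ u.range)}) :=
    (Set.toFinite _).isOpen_biInter fun j _ ↦ isOpen_setOf_disjoint_interior_union_range (isCompact_closedBall _ _)
  convert (h1.inter h2).inter h3 using 1
  ext u
  simp only [mem_setOf_eq, mem_inter_iff, mem_iInter]
  tauto

/-- The typed pattern count is the number of loops of type `i` in the (open) pattern set. -/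
theorem typedPatternCount_eq_ncard (c : LoopConfig ℂ) (i : Fin 2) {n : ℕ} (x : Fin n → ℂ) (r : Fin n → ℝ)
    (R : ℝ) (S : Finset (Fin n)) :
    typedPatternCount c i x r R S = (c.F i ∩ {u : UnbasedLoop ℂ | u.range ⊆ ball (0 : ℂ) R ∧
      (∀ j ∈ S, closedBall (x j) (r j) ⊆ {w | u.wind w ≠ 0}) ∧
      ∀ j, j ∉ S → Disjoint (closedBall (x j) (r j)) ({w | u.wind w ≠ 0} ∪ u.range)}).ncard := by
  unfold typedPatternCount patternCount
  congr 1
  ext u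
  simp only [LoopConfig.loops, mem_setOf_eq, mem_inter_iff, mem_union]
  fin_cases i <;> simp

/-- **Measurable typed counts from measurable hitting events.** -/
theorem measurable_typedPatternCount_of_hit {T : Type} [MeasurableSpace T] {X : T → LoopConfig ℂ}
    (hX : ∀ (i : Fin 2) (Q : Set (UnbasedLoop ℂ)), IsClosed Q → MeasurableSet {t | ∃ u ∈ (X t).F i, u ∈ Q})
    (i : Fin 2) (n : ℕ) (x : Fin n → ℂ) (r : Fin n → ℝ) (R : ℝ) (S : Finset (Fin n)) :
    Measurable fun t ↦ typedPatternCount (X t) i x r R S := by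
  simp only [typedPatternCount_eq_ncard]
  exact softMachine_measurable_ncard_of_hit T X hX i _ (isOpen_patternSet x r R S)

end SoftMachine

/-! ### `TamePrecompact` from tame-regular modification of hit-measurable limit presentations -/

/-- **Registered anchor** (`tamePrecompact_tEns_of_tameRegularModification`): `TamePrecompact tEns` follows from the
sole statement that every sequential `d_CN`-limit presentation of `tEns` on `([0,1], Leb)` with measurable hitting
events can be replaced by one with measurable hitting events, a.e. `Regular` values all of whose loops are `Tame`,
and the same limit property along the same mesh sequence.  (The soft machine supplies the hit-measurable limit
presentations, bricks 6–9; hit-measurability gives the measurable typed counts, brick 12 and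
`SoftMachine.measurable_typedPatternCount_of_hit`, and the measurable closeness events at every mesh against both
lattices, brick 7b.) -/
theorem tamePrecompact_tEns_of_tameRegularModification :
    (∀ (δs : ℕ → ℝ) (X : unitInterval → LoopConfig ℂ), Tendsto δs atTop (𝓝[>] (0 : ℝ)) →
      (∀ (i : Fin 2) (Q : Set (UnbasedLoop ℂ)), IsClosed Q → MeasurableSet {s | ∃ u ∈ (X s).F i, u ∈ Q}) →
      Tendsto (fun k : ℕ ↦ LoopConfig.cnLawEDist tEns.P (tEns.X (δs k)) volume X) atTop (𝓝 0) →
      ∃ X' : unitInterval → LoopConfig ℂ,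
        (∀ (i : Fin 2) (Q : Set (UnbasedLoop ℂ)), IsClosed Q → MeasurableSet {s | ∃ u ∈ (X' s).F i, u ∈ Q}) ∧
        (∀ᵐ s : unitInterval, Regular (X' s) ∧ ∀ u ∈ (X' s).loops, Tame u) ∧
        Tendsto (fun k : ℕ ↦ LoopConfig.cnLawEDist tEns.P (tEns.X (δs k)) volume X') atTop (𝓝 0)) →
    TamePrecompact tEns := by
  intro hmod δs hδs
  obtain ⟨φ, hφ, X, hXhit, -, hconv⟩ := precompactLaw_measurable_hit_tEns δs hδs
  obtain ⟨X', hX'hit, hreg, hconv'⟩ := hmod (δs ∘ φ) X (hδs.comp hφ.tendsto_atTop) hXhit hconv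
  exact ⟨φ, hφ, X', hreg, fun i n x r R S ↦ SoftMachine.measurable_typedPatternCount_of_hit hX'hit i n x r R S,
    fun ε δ E' hE' ↦ softMachine_measurableSet_isClose_latticeEnsembles_all E' hE' δ ε unitInterval X' hX'hit,
    hconv'⟩

/-- The same for `zEns`, given the bond multiple-traversal estimate (brick 11). -/
theorem tamePrecompact_zEns_of_traversalBound_of_tameRegularModification
    (hH1 : ∃ (k : ℕ) (K lam : ℝ), 0 ≤ K ∧ 2 < lam ∧ ∀ (M : Set (Sym2 (Site 2))) (δ : ℝ), δ ∈ Set.Ioc (0 : ℝ) 1 →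
      ∀ (x : ℂ) (ρ R : ℝ), δ ≤ ρ → ρ < R → R ≤ 1 →
        bondPercolation (zdGraph 2) half {ω | ∃ γ : List MedialVertex, IsInterfaceLoop (ω ∩ M) γ ∧
          (⟨Literature.Probability.LatticeModels.polyline ((γ ++ γ.take 1).map (medialPoint δ))⟩ : Curve ℂ).HasTraversals
            k x ρ R} ≤ ENNReal.ofReal (K * (ρ / R) ^ lam))
    (hmod : ∀ (δs : ℕ → ℝ) (X : unitInterval → LoopConfig ℂ), Tendsto δs atTop (𝓝[>] (0 : ℝ)) →
      (∀ (i : Fin 2) (Q : Set (UnbasedLoop ℂ)), IsClosed Q → MeasurableSet {s | ∃ u ∈ (X s).F i, u ∈ Q}) →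
      Tendsto (fun k : ℕ ↦ LoopConfig.cnLawEDist zEns.P (zEns.X (δs k)) volume X) atTop (𝓝 0) →
      ∃ X' : unitInterval → LoopConfig ℂ,
        (∀ (i : Fin 2) (Q : Set (UnbasedLoop ℂ)), IsClosed Q → MeasurableSet {s | ∃ u ∈ (X' s).F i, u ∈ Q}) ∧
        (∀ᵐ s : unitInterval, Regular (X' s) ∧ ∀ u ∈ (X' s).loops, Tame u) ∧
        Tendsto (fun k : ℕ ↦ LoopConfig.cnLawEDist zEns.P (zEns.X (δs k)) volume X') atTop (𝓝 0)) :
    TamePrecompact zEns := by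
  intro δs hδs
  obtain ⟨k₀, hk₀⟩ := eventually_atTop.1 (hδs.eventually (Ioc_mem_nhdsGT one_pos))
  obtain ⟨φ, hφ, X, hXhit, hconv⟩ :=
    SoftMachine.exists_subseq_limit_bondLoopConfig hH1 (fun k ↦ δs (k + k₀)) fun k ↦ hk₀ _ (Nat.le_add_left _ _)
  have hφ' : StrictMono fun k ↦ φ k + k₀ := hφ.add_const k₀
  obtain ⟨X', hX'hit, hreg, hconv'⟩ := hmod (δs ∘ fun k ↦ φ k + k₀) X (hδs.comp hφ'.tendsto_atTop) hXhit hconv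
  exact ⟨fun k ↦ φ k + k₀, hφ', X', hreg,
    fun i n x r R S ↦ SoftMachine.measurable_typedPatternCount_of_hit hX'hit i n x r R S,
    fun ε δ E' hE' ↦ softMachine_measurableSet_isClose_latticeEnsembles_all E' hE' δ ε unitInterval X' hX'hit,
    hconv'⟩

end Summit.CriticalPhenomena.CardyFormulaZ2.Cruxes.NestingRigidity.PositiveConeWeightDoubling

end
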